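import Summits.QuantumFields.YangMills.Theorems.SwapVirialDeficitPeriodicPrincipalLogLimit
import HarnessLib

/-!
# The PERIODIC massive-mode rung, PJ6 at a GENERAL LEVEL `r·t²`: the principal zero-flux log-limit from two-scale bounds for `periodicKernel 0 1 t (r·t²)`
# (free-hands support of ⟨stmt-QuantumFields-24196⟩ `SwapVirialDeficit.ToronSoftnessSharp`; LEAD memo `sfw-p2-g96-memo-24196-PM-design.md` §2, «good-threshold
# route»: the null level `{Φ(0,0;·) = r}` of the two-scale limit fails for at most countably many `r`, so PM may pick its level — this file lets PJ6 accept it)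

w3 g64's ✓`periodicPrincipalLogLimit_of_twoScale` fixes the level `s = t²`.  Verbatim the same argument at level `s = r·t²` (`r > 0`; ✓PD-II
`periodicKernel_deep`/`periodicKernel_outer` are already stated for `r·t²`) gives
★★★ `periodicPrincipalLogLimit_of_twoScale_level`: (upper)/(lower) for `K t := periodicKernel L 0 1 t (r·t²)` ⟹
`μ_L.real{F₀ ≤ s}/(s^{9L⁴−3/2}·log s⁻¹) → coneConst^{6L⁴+1}·gI/(4·r^{9L⁴−3/2})`, via the reparametrisation `s = r·u`, `t = √u` and
`log(1/√u)/log s⁻¹ → 1/2` (`log_ratio_tendsto`).  ★★ `periodicMeanAction_fixedL_of_twoScale_level` then feeds ✓`tendsto_periodicMeanAction_of_principalLogLimit`.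
HONEST LABEL: one-variable real analysis (plan-level fixed-`L` rung of a DRAFT line); PM NOT proved; ⟨24196⟩/⟨24194⟩/⟨24197⟩/⟨24497⟩ OPEN; own crux ⟨22884⟩ OPEN
(blocked-on ⟨19935⟩); the Yang–Mills mass gap is NOT proved; no summit is proved by a line.
LEAD seat ym-line-sfw-p2 g96 (cell ym-idea-1, free hands), `--supports stmt-QuantumFields-24196`.  THEOREMS ONLY, standard axioms, 0 `sorry`.
References: [cite: Luscher1983, §2]; [cite: GonzalezarroyoAltes1988]; [folklore].
-/

set_option autoImplicit false

noncomputable section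

open MeasureTheory Quaternion Set Filter Topology
open scoped Quaternion ENNReal BigOperators
open Literature.MathematicalPhysics.QuantumLattice
open Literature.MathematicalPhysics.QuantumFieldTheory hiding SU2
open Summit.QuantumFields.YangMills.Theorems.SwapTwistDeficit.ToronLog

namespace Summit.QuantumFields.YangMills.Theorems.SwapVirialDeficit.BlowUpRing

open Summit.QuantumFields.YangMills.Theorems.FemtoTransferGap
open Summit.QuantumFields.YangMills.Theorems.FemtoTransferGap.TT
open Summit.QuantumFields.YangMills.Theorems.VirialFluxGap.RingDeficit
open Summit.QuantumFields.YangMills.Theorems.SwapVirialDeficit.BlowUp (tendsto_div_log_of_twoScale)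
open Summit.QuantumFields.YangMills.Theorems.SwapVirialDeficit.PeriodicRing (tendsto_periodicMeanAction_of_principalLogLimit)

variable {L : ℕ} [NeZero L]

/-- `s ↦ s / r` maps `𝓝[>] 0` into `𝓝[>] 0` (`r > 0`). [folklore] -/
theorem tendsto_div_const_nhdsGT_zero {r : ℝ} (hr : 0 < r) : Tendsto (fun s : ℝ => s / r) (𝓝[>] (0 : ℝ)) (𝓝[>] (0 : ℝ)) := by
  refine tendsto_nhdsWithin_iff.2 ⟨?_, ?_⟩
  · have h : Tendsto (fun s : ℝ => s / r) (𝓝 (0 : ℝ)) (𝓝 ((0 : ℝ) / r)) := tendsto_id.div_const r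
    rw [zero_div] at h
    exact tendsto_nhdsWithin_of_tendsto_nhds h
  · filter_upwards [self_mem_nhdsWithin] with s hs using div_pos hs hr

/-- `log (s/r)⁻¹ / log s⁻¹ → 1` as `s → 0⁺` (`r > 0`): the level only shifts the logarithm by a constant. [folklore] -/
theorem log_ratio_tendsto {r : ℝ} (hr : 0 < r) :
    Tendsto (fun s : ℝ => Real.log (s / r)⁻¹ / Real.log s⁻¹) (𝓝[>] (0 : ℝ)) (𝓝 1) := by
  have hlog : Tendsto (fun s : ℝ => Real.log s⁻¹) (𝓝[>] (0 : ℝ)) atTop := by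
    have h := Real.tendsto_log_nhdsGT_zero
    have e : (fun s : ℝ => Real.log s⁻¹) = fun s => -Real.log s := funext fun s => Real.log_inv s
    rw [e]
    exact tendsto_neg_atBot_atTop.comp h
  have hconst : Tendsto (fun s : ℝ => Real.log r / Real.log s⁻¹) (𝓝[>] (0 : ℝ)) (𝓝 0) := hlog.const_div_atTop (Real.log r)
  have hsum : Tendsto (fun s : ℝ => 1 + Real.log r / Real.log s⁻¹) (𝓝[>] (0 : ℝ)) (𝓝 1) := by
    simpa using hconst.const_add 1
  refine hsum.congr' ?_
  filter_upwards [self_mem_nhdsWithin, hlog.eventually (eventually_gt_atTop 0)] with s hs hpos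
  have hs0 : (0 : ℝ) < s := hs
  have hne : Real.log s⁻¹ ≠ 0 := hpos.ne'
  have hsplit : Real.log (s / r)⁻¹ = Real.log s⁻¹ + Real.log r := by
    rw [inv_div, Real.log_div hr.ne' hs0.ne', Real.log_inv]; ring
  rw [hsplit, add_div, div_self hne]

/-- ★★★ **THE PERIODIC PRINCIPAL LOG-LIMIT AT LEVEL `r`, MODULO PM.**  If on the middle region the periodic kernel at level `r·t²`,
`K_t = periodicKernel 0 1 t (r t²)`, has a two-scale majorant and minorant `G(a₀)/ρ` with total mass within `ε` of `gI ≥ 0`, then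
`μ_L.real{F₀ ≤ s}/(s^{9L⁴−3/2}·log s⁻¹) → coneConst^{6L⁴+1}·gI/(4·r^{9L⁴−3/2})` as `s → 0⁺`. [cite: Luscher1983, §2] [cite: GonzalezarroyoAltes1988] -/
theorem periodicPrincipalLogLimit_of_twoScale_level (L : ℕ) [NeZero L] {r : ℝ} (hr : 0 < r) {gI : ℝ} (hgI : 0 ≤ gI)
    (hupper : ∀ ε : ℝ, 0 < ε → ∃ A δ : ℝ, 0 < A ∧ 0 < δ ∧ ∃ G : ℝ → ℝ≥0∞, ∫⁻ x, G x ∂(volume : Measure ℝ) ≤ ENNReal.ofReal (gI + ε) ∧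
      ∀ᶠ t in 𝓝[>] (0 : ℝ), ∀ a₀ : ℝ, ∀ ρ ∈ Ioc (A * Real.sqrt t) δ,
        periodicKernel L (fun _ => false) (fun _ => 1) t (r * t ^ 2) (a₀, ρ) ≤ G a₀ * ENNReal.ofReal ρ⁻¹)
    (hlower : ∀ ε : ℝ, 0 < ε → ∃ A δ : ℝ, 0 < A ∧ 0 < δ ∧ ∃ G : ℝ → ℝ≥0∞, ENNReal.ofReal (gI - ε) ≤ ∫⁻ x, G x ∂(volume : Measure ℝ) ∧
      ∀ᶠ t in 𝓝[>] (0 : ℝ), ∀ a₀ : ℝ, ∀ ρ ∈ Ioc (A * Real.sqrt t) δ,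
        G a₀ * ENNReal.ofReal ρ⁻¹ ≤ periodicKernel L (fun _ => false) (fun _ => 1) t (r * t ^ 2) (a₀, ρ)) :
    Tendsto (fun s : ℝ => (ringMeasure L).real {P | ringDeficit L (fun _ => false) P ≤ s} / (s ^ (9 * (L : ℝ) ^ 4 - 3 / 2) * Real.log s⁻¹))
      (𝓝[>] 0) (𝓝 (coneConst ^ (6 * L ^ 4 + 1) * gI / (4 * r ^ (9 * (L : ℝ) ^ 4 - 3 / 2)))) := by
  set α : ℝ := 9 * (L : ℝ) ^ 4 - 3 / 2 with hαdef
  set K : ℝ → ℝ × ℝ → ℝ≥0∞ := fun t => periodicKernel L (fun _ => false) (fun _ => 1) t (r * t ^ 2) with hK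
  have hKm : ∀ t, Measurable (K t) := fun t => measurable_periodicKernel _ _ t _
  have hdeep : ∀ A : ℝ, 0 < A → ∃ C : ℝ≥0∞, C ≠ ∞ ∧ ∀ᶠ t in 𝓝[>] (0 : ℝ),
      ∫⁻ x, (∫⁻ ρ in Ioc 0 (A * Real.sqrt t), K t (x, ρ)) ∂(volume : Measure ℝ) ≤ C :=
    fun A hA => periodicKernel_deep (L := L) hr.le A hA
  have houter : ∀ δ : ℝ, 0 < δ → ∃ C : ℝ≥0∞, C ≠ ∞ ∧ ∀ᶠ t in 𝓝[>] (0 : ℝ),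
      ∫⁻ x, (∫⁻ ρ in Ioi δ, K t (x, ρ)) ∂(volume : Measure ℝ) ≤ C :=
    fun δ hδ => periodicKernel_outer (L := L) hr.le δ hδ
  have hT := tendsto_div_log_of_twoScale (volume : Measure ℝ) hKm hgI hdeep houter hupper hlower
  -- reparametrise: `s = r·u`, `t = √u`
  have hT2 := hT.comp (tendsto_sqrt_nhdsGT_zero.comp (tendsto_div_const_nhdsGT_zero hr))
  have hL := log_ratio_tendsto hr
  have hc0 : 0 ≤ coneConst := by rw [coneConst]; exact ENNReal.toReal_nonneg
  -- the product of the two limits and the constant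
  have hprod : Tendsto (fun s : ℝ => coneConst ^ (6 * L ^ 4 + 1) / (2 * r ^ α) *
      (((∫⁻ x, (∫⁻ ρ in Ioi 0, K (Real.sqrt (s / r)) (x, ρ)) ∂(volume : Measure ℝ)).toReal / Real.log (1 / Real.sqrt (s / r))) *
        (Real.log (s / r)⁻¹ / Real.log s⁻¹))) (𝓝[>] (0 : ℝ))
      (𝓝 (coneConst ^ (6 * L ^ 4 + 1) / (2 * r ^ α) * ((gI / 2) * 1))) := (hT2.mul hL).const_mul _
  have htarget : coneConst ^ (6 * L ^ 4 + 1) * gI / (4 * r ^ α) = coneConst ^ (6 * L ^ 4 + 1) / (2 * r ^ α) * ((gI / 2) * 1) := by ring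
  rw [htarget]
  refine hprod.congr' ?_
  filter_upwards [self_mem_nhdsWithin, Ioo_mem_nhdsGT (show (0 : ℝ) < min 1 r by positivity)] with s hs hs1
  have hs0 : 0 < s := hs
  have hsr : s < r := hs1.2.trans_le (min_le_right _ _)
  have hs1' : s < 1 := hs1.2.trans_le (min_le_left _ _)
  have hu0 : 0 < s / r := div_pos hs0 hr
  have hsq : 0 < Real.sqrt (s / r) := Real.sqrt_pos.2 hu0
  -- the sublevel volume through the kernel at `t = √(s/r)`, level `r·(s/r) = s`
  have hvol := ringMeasure_ringDeficit_le_eq_kernel_sqrt (L := L) (fun _ => false) (χ := fun _ => 1) (fun _ k => by rw [one_mul, mul_one]) r hu0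
  have hrs : r * (s / r) = s := by field_simp
  rw [hrs] at hvol
  have hlog : Real.log (1 / Real.sqrt (s / r)) = Real.log (s / r)⁻¹ / 2 := by
    rw [one_div, Real.log_inv, Real.log_inv, Real.log_sqrt hu0.le]; ring
  have hlogu : 0 < Real.log (s / r)⁻¹ := Real.log_pos (one_lt_inv₀ hu0 |>.2 (by rw [div_lt_one hr]; exact hsr))
  have hlogs : 0 < Real.log s⁻¹ := Real.log_pos (one_lt_inv₀ hs0 |>.2 hs1')
  have hαu : 0 < (s / r) ^ α := Real.rpow_pos_of_pos hu0 _
  have hαs : 0 < s ^ α := Real.rpow_pos_of_pos hs0 _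
  have hαr : 0 < r ^ α := Real.rpow_pos_of_pos hr _
  have hsplit : (s / r) ^ α = s ^ α / r ^ α := Real.div_rpow hs0.le hr.le α
  rw [← hαdef, hsplit] at hvol
  have h1 : Real.log (r / s) ≠ 0 := by rw [← inv_div]; exact hlogu.ne'
  have h2 : Real.log (1 / s) ≠ 0 := by rw [one_div]; exact hlogs.ne'
  have h3 : Real.log (s / r)⁻¹ ≠ 0 := hlogu.ne'
  have h4 : Real.log s⁻¹ ≠ 0 := hlogs.ne'
  rw [measureReal_def, hvol, ENNReal.toReal_mul, ENNReal.toReal_ofReal (by positivity), hlog]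
  simp only [hK, Real.sq_sqrt hu0.le, hrs]
  field_simp

/-- ★★ **THE FIXED-`L` PERIODIC MEAN ACTION MODULO PM AT LEVEL `r`** (`gI > 0`). [cite: Griffiths1964] [cite: Luscher1983, §2] -/
theorem periodicMeanAction_fixedL_of_twoScale_level (L : ℕ) [NeZero L] {r : ℝ} (hr : 0 < r) {gI : ℝ} (hgI : 0 < gI)
    (hupper : ∀ ε : ℝ, 0 < ε → ∃ A δ : ℝ, 0 < A ∧ 0 < δ ∧ ∃ G : ℝ → ℝ≥0∞, ∫⁻ x, G x ∂(volume : Measure ℝ) ≤ ENNReal.ofReal (gI + ε) ∧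
      ∀ᶠ t in 𝓝[>] (0 : ℝ), ∀ a₀ : ℝ, ∀ ρ ∈ Ioc (A * Real.sqrt t) δ,
        periodicKernel L (fun _ => false) (fun _ => 1) t (r * t ^ 2) (a₀, ρ) ≤ G a₀ * ENNReal.ofReal ρ⁻¹)
    (hlower : ∀ ε : ℝ, 0 < ε → ∃ A δ : ℝ, 0 < A ∧ 0 < δ ∧ ∃ G : ℝ → ℝ≥0∞, ENNReal.ofReal (gI - ε) ≤ ∫⁻ x, G x ∂(volume : Measure ℝ) ∧
      ∀ᶠ t in 𝓝[>] (0 : ℝ), ∀ a₀ : ℝ, ∀ ρ ∈ Ioc (A * Real.sqrt t) δ,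
        G a₀ * ENNReal.ofReal ρ⁻¹ ≤ periodicKernel L (fun _ => false) (fun _ => 1) t (r * t ^ 2) (a₀, ρ)) :
    Tendsto (fun b : ℝ => b * deriv (fun x : ℝ => Real.log (TT.sectorWeight (L := L) x (2 * L - 1) (fun _ => false) (fun _ _ => (1 : ℝ)))) b -
        12 * b * (L : ℝ) ^ 4) atTop (𝓝 (-(9 * (L : ℝ) ^ 4 - 3 / 2))) := by
  have hc : 0 < coneConst := coneConst_pos
  have hv : 0 < coneConst ^ (6 * L ^ 4 + 1) * gI / (4 * r ^ (9 * (L : ℝ) ^ 4 - 3 / 2)) := by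
    have : 0 < r ^ (9 * (L : ℝ) ^ 4 - 3 / 2) := Real.rpow_pos_of_pos hr _
    positivity
  exact tendsto_periodicMeanAction_of_principalLogLimit L hv (periodicPrincipalLogLimit_of_twoScale_level L hr hgI.le hupper hlower)

end Summit.QuantumFields.YangMills.Theorems.SwapVirialDeficit.BlowUpRing

end
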